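import Literature.MathematicalPhysics.QuantumFieldTheory.Balaban1985CMP102.Setting
import Literature.MathematicalPhysics.QuantumFieldTheory.Balaban1983to89.T4TreeGaugeFixing

/-!
# Bałaban CMP 102 (1985) 255–275, AS-PRINTED SPINE — `SectA`: Sect. A «A Discussion of the First Renormalization
# Transformation», pp. 257–265 = PDF 3–11: the displays (9), (14)–(16) that the 4D cell's modules do not type, and the
# coverage map of (7)–(37) onto the modules that do

Source: T. Bałaban, *Ultraviolet stability of three-dimensional lattice pure gauge field theories*, Commun. Math. Phys.
**102** (1985) 255–275 [Balaban1985UV3] ([B10]; `paper:balaban1985-cmp102-uv-stability-3d`; PDF page = journal page −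
254).  Every quotation below was READ AS AN IMAGE on the renders `run/shared/lean/pub/pub-balaban/b2b-balaban-ref1/pages/
1985-cmp102-uv-stability-3d/…-p004-x2.png` … `…-p011-x2.png` (pp. 258–265; the displays are garbled in the text layer);
the seat's line-by-line transcription of pp. 258–267 is `HOME/drafts/typer-1/TRANSCRIPTION-pp258-267.md` (lane
pub-balaban3d).  Locators `p. N = PDF n Lnn`: journal page, PDF page, line of the text-layer file `p000n.txt`.
[4] = [Balaban1985Averaging] (CMP 98), [6] = [Balaban1985RegularSpaces] (CMP 99:75), [7] = [Balaban1985Variational]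
(CMP 102:277), [5] = [Balaban1985BackgroundPropagators] (CMP 99:389).

HONEST FRAMING (lane PLAN.md §0).  Sect. A is the PROOF NARRATIVE of the first step `ρ₁ = Tρ₀` ending in the bounds
(36)/(37); its displays are identities and inequalities between objects of [4]–[7].  The 4D cell (`…Balaban1983to89`,
«LQB») already types or certifies almost all of them over its carriers; this file adds ONLY the three displays it does
not carry as statements — (9) (the Faddeev–Popov identity of the block axial gauge), (10) (the first renormalization
step with the decomposition (8) inserted, in the tree's push-forward reading — lane ruling R-EQ10′), (14)–(15) (the averaged fluctuation
field in the chart `U′ = e^{iA′}` and the decomposition of `Q(A′)`), (16) (the δ-function change of variables to the Lie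
algebra) — each as a `def … : Prop` over the smallest carrier print names, HYPOTHESIS-SHAPED (nothing is asserted; (9)
is a consequence of the invariance of Haar measure — PROVED by the lane's prover seat p4, `eq9_holds`, over these very
decls; (10) is the carrier seat p1's theorem `formula10_sum` — both Summits-side, not imported here).  Everything else is
RE-USED BY NAME; the map (display → LQB decl, render-confirmed by this seat's transcription) is:
(7) p. 257 L31–35 `B10.pFun`/`B10.rFun` + `B10Decomposition7.decomposition7_eps1` (the decomposition of unity with
ε₁ = g₀p(g₀)); (8) p. 258 L2–7 `B10Decomposition7.resummation8_printed_indicator` (Σ over admissible Ω₁ of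
ζ_{Ω₁ᶜ}χ_{Ω₁} = 1); (12) p. 258 L34–p. 259 L7 `B10SectAStatements.FirstStep`/`Eq12` (binder [7] Thm 1 = typer-2's
`Binders`); (11) p. 258
L20–24 `B10Eq11Trace`, `B10.smallFactor_le_pow`, `B10.gsq_psq_le`; (13) p. 259 L8–21 `B10Eq13Enlargement`,
`B10Eq13RegularityClaims` (binder [6] Lemma 1); (17) p. 260 L1–3 `B10SectAStatements.Eq17`, `B10Eq17LocalSolution`,
`B10Eq17LocalTorus`, `B10Eq20Locality`; (18)–(19) pp. 260–261 `B10Eq19LinearTerm` (binder [7] (26)); (20) p. 261 L8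
`B10Eq20Locality`; (21) p. 261 L12 `B10Eq22Rescaling.eq21`/`eq21_sigma` (PROVED there: a finite product of positive factors
is `exp Σ log`); (22) p. 261 L20 `B10Eq22Rescaling` (first member, constants `log σ₀|Ω₁*| + d(𝔤) log g₀|Ω₁*|` PROVED),
`B10StarCount` (`|Ω₁*|`); p. 262 L1–3 remainder `O(g₀⁷p¹⁸(g₀))|Ω₁| ≤ O(ε^{3+κ₀})|T₁|` = `LeafSystem.rem_eq` units; (23) p. 262
L19 binder [5] (3.108) (typer-2 `Binders`); (24)–(25) p. 262 L32–39 `B10Eq24Cumulant`, `B10Eq25Rate`, `B10.Bound25Printed`;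
(26) p. 263 L3 `B10Eq26MeasureInv`/`SiteGauge`/`SuSlice`/`TubeIdentity`; (27)–(28) p. 263 L25–28 `B10Eq27AxialLog`,
`B10Eq28RegularTube`/`CplxRegTube` (binder [7] Sect. F, (158)); (29)–(30) p. 263 L35–38 `B10Eq29TubeLine`/`CplxLine` …;
(31)–(32) p. 264 L3–8 `B10.invariant_vector_eq_zero`, `B10Eq31GlobalConj`, `B10Eq32SuN`/`AxialSuN`/`RegularSuN`
(«It is the only place we use the semi-simplicity», p. 264 L9); (33)–(34) p. 264 L28–35: (33) = the leaf `B10SectAGathering.Repr33_60 (T) (k := 0) P C` (the representation «Σ_X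
𝒫′(X,U₁) = Σ_X 𝒫′(X,1) + Σ_Y 𝒫(Y,U₁) + remainder» at the first step) and (34) = `B10SectCExpansion.Shape43 X P κ₁ M₁
(ℓ := 1) C` — the instantiation `ℓ = L^jη = 1` (j = k = 1 before rescaling: unit lattice, big blocks of size M₁) of the
per-term shape «𝒫₁(g₀,Y,U₁) = ⟨𝒫₁(g₀,Y), B(c₁), …, B(c_n)⟩, n ≥ 2, |𝒫₁(g₀,Y)| ≤ O(1)Π exp(−κ₁M₁^{−1}|c_{i,−} − y|)»
(whose docstring types (34) as the first-step case of (43)); (35) p. 265 L13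
`B10Eq35Norm`, leaves `Norm35`/`VacuumWhole`; (36)–(37) p. 265 L19–29 `B10.FirstStep36_37Printed`,
`B10SectAGathering.firstStep36_37_of_leaves` (the displays (36), (37) are EMPTY in the text layer; transcribed from the
render p011 in the seat's transcription: (36) «(Tρ₀)(V) = ρ₁(V) ≤ Σ_{Ω₁} χ₁ ∫dV₀↾_{Ω₁ᶜ} δ(V̄₀V^{−1}) ζ_{Ω₁ᶜ} exp[−(1/g₁²)
A^{L^{−1}}(U₁) + Σ_Y 𝒫₁(g₀,Y,U₁) − E₁ + O(log g₀^{−1})|Ω₁ᶜ| + O(ε^{3+κ₀})|T₁|], where g₁ = g(Lε)^{1/2}, E₁ = E − E^{(0)}, and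
E^{(0)} = log σ₀|T₁*| + d(𝔤) log g₀|T₁*| + log Z^{(0)}(T₁, 1) + Σ_X 𝒫′₁(g₀,X,1)»; (37) «ρ₁(V) ≥ χ₁ exp[−(1/g₁²)A^{L^{−1}}(U₁) +
Σ_Y 𝒫₁(g₀,Y,U₁) − E₁ − O(ε^{3+κ₀})|T₁|]» with χ₁ ↔ «|U₁(∂p) − 1| < L^{−2}g₀p(g₁)» ⟦sic, as printed⟧).
WHAT IS NOT HERE: any construction (`Q`, `D̃`, `σ`, the averages are binders); the step-k versions (48)–(63) (typer-2's
`SectC`); theorems with content.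
-/

namespace Literature.MathematicalPhysics.QuantumFieldTheory.Balaban1985CMP102.SectA

open Literature.MathematicalPhysics.QuantumFieldTheory.Balaban1983to89
open _root_.MeasureTheory

/-! ## (9) p. 258 = PDF 4 L8–13: the Faddeev–Popov identity of the block axial gauge -/

section Eq9

variable {P : Balaban1983to89.Params} {j : ℕ} {G : Type} [Balaban1983to89.GaugeGroup G] [MeasurableSpace G]
  [Balaban1983to89.HaarData G]

/-- The sites `x ∈ B(y), x ≠ y` of (9) — the variables `u(x)` integrated over in one block (print: «gauge transformations u
fixed to 1 at points of the new lattice T^{(1)}, i.e. u(y) = 1 for y ∈ T^{(1)}»; `Setup.block`, `Setup.emb` = the point `y`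
of the fine lattice; their number per block is `L^d − 1`, `B10StarCount.axialCount`). [cite: Balaban1985UV3, (9) p.258] -/
def AxSites (y : Balaban1983to89.Site P (j + 1)) : Type :=
  {x : Balaban1983to89.Site P j // x ∈ Balaban1983to89.block y ∧ x ≠ Balaban1983to89.emb y}

/-- `AxSites y` is finite (a subtype of the finite torus). [folklore] -/
noncomputable instance (y : Balaban1983to89.Site P (j + 1)) : Fintype (AxSites y) := by
  unfold AxSites; exact Fintype.ofFinite _

/-- The gauge transformation of one block of (9): `u(x)` at the sites `x ∈ B(y), x ≠ y`, and `u = 1` elsewhere (in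
particular «u(y) = 1 for y ∈ T^{(1)}», p. 258 L9). [cite: Balaban1985UV3, (9) p.258] -/
noncomputable def blockTransf (y : Balaban1983to89.Site P (j + 1)) (u : AxSites y → G) :
    Balaban1983to89.GaugeTransf P j G :=
  fun z => by
    classical
    exact if h : z ∈ Balaban1983to89.block y ∧ z ≠ Balaban1983to89.emb y then u ⟨z, h⟩ else 1

/-- **(9)** p. 258 = PDF 4 L8–13, verbatim: «The underintegral expression in Tρ₀ is invariant with respect to gauge
transformations u fixed to 1 at points of the new lattice T^{(1)}, i.e. u(y) = 1 for y ∈ T^{(1)}. We remove this freedom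
in the domain Ω₁ by a simple Faddeev–Popov procedure, using the identity  Π_{y∈Ω₁^{(1)}} ∫ Π_{x∈B(y),x≠y} du(x)
δ_{Ax(y)}(U^u) = 1,  (9)   δ_{Ax(y)}(U) = Π_{x∈B(y),x≠y} δ(U(Γ_{y,x})).»  Typed in the tree's push-forward reading of
δ-function identities (cell DIVERGENCE F7), one block `y` at a time (the factors of the printed product over
`y ∈ Ω₁^{(1)}` are independent, since `δ_{Ax(y)}(U^u)` sees `u` only on `B(y)`): for EVERY configuration `U`, the map
`u ↦ (U^u(Γ_{y,x}))_{x∈B(y),x≠y}` pushes the product Haar measure `Π du(x)` forward to the product Haar measure on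
`G^{B(y)∖{y}}` — so the δ-function `δ_{Ax(y)}` (supported on the block axial gauge `Setup.AxialGauge`) integrates to 1.
Carrier: the contours `Γ_{y,x}` of [4]/(1.7) of [Balaban1984PropagatorsI] enter through `Setup.ContourData` (`holTo U y x
= U(Γ_{y,x})`, gauge covariance `holTo (U^u) y x = u(y) U(Γ_{y,x}) u(x)^{−1}`).  Hypothesis-shaped leaf (its proof is the
left- and inversion-invariance of Haar measure, fields of `Setup.HaarData`; PROVED for every contour system by the lane's
prover seat p4, `eq9_holds`, Summits-side). [cite: Balaban1985UV3, (9) p.258] -/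
def Eq9 (cd : Balaban1983to89.ContourData P j G) : Prop :=
  ∀ (U : Balaban1983to89.GaugeField P j G) (y : Balaban1983to89.Site P (j + 1)),
    Measure.map
        (fun u : AxSites y → G => fun x : AxSites y =>
          cd.holTo (Balaban1983to89.GaugeField.gaugeAct (blockTransf y u) U) y x.1)
        (Measure.pi fun _ : AxSites y => (Balaban1983to89.HaarData.haar : Measure G)) =
      Measure.pi fun _ : AxSites y => (Balaban1983to89.HaarData.haar : Measure G)

end Eq9

/-! ## (10) p. 258 = PDF 4 L14–19: the first renormalization step with the decomposition (8) inserted -/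

section Eq10

variable {L : ℕ} {S : Setting.Scales L} {G : Type} [Balaban1983to89.GaugeGroup G] [MeasurableSpace G]
  [Balaban1983to89.HaarData G]

open Classical in
/-- **(10)** p. 258 = PDF 4 L7–18, verbatim (render p004; (9) = L10–13, (10) = L14–18): «The underintegral
expression in Tρ₀ is invariant with respect to gauge transformations u fixed to 1 at points of the new lattice T^{(1)},
i.e. u(y) = 1 for y∈T^{(1)}. We remove this freedom in the domain Ω₁ by a simple Faddeev–Popov procedure, using the
identity  Π_{y∈Ω₁^{(1)}} ∫ Π_{x∈B(y),x≠y} du(x) δ_{Ax(y)}(U^u) = 1,  (9)  δ_{Ax(y)}(U) = Π_{x∈B(y),x≠y} δ(U(Γ_{y,x})).  We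
obtain the following equality  (Tρ₀)(V) = Σ_{Ω₁} ∫dU δ(ŪV^{−1}) δ_{Ax(Ω₁)}(U) ζ_{Ω₁ᶜ} χ_{Ω₁} × exp[−(1/g₀²)A(U) − E],
(10)  where δ_{Ax(Ω₁)}(U) = Π_{y∈Ω₁^{(1)}} δ_{Ax(y)}(U).» ⟦reading (lane ruling R-EQ10′ = the prover seat p1's provable
signature; tree convention `Setup.IsRT`, cell DIVERGENCE F7): «(Tρ₀)(V)» ↦ `R.rho 1 V` ((2), `= (R.T 0).T R.rho0` by
`rfl`); «∫dU δ(ŪV^{−1}) …» ↦ the push-forward identity tested against every bounded measurable `f` of `V`, `Ū` =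
`(R.av 0).avg`; «Σ_{Ω₁}» ↦ `∑ i ∈ s` over a finite index set of admissible regions (print's instantiation: `s` =
`B10Decomposition7.admissible T dom`, the images of the large-field sets `P` under the Ω₁-rule of p. 257 L36–39);
«δ_{Ax(Ω₁)}(U)» ↦ evaluation of the integrand at `T4TreeGaugeFixing.fixTo (Ax i) 1 U` = `U` with `U(b) := 1` on the
axial bonds `Ax i` = the bonds of the contours Γ_{y,x}, y ∈ Ω₁^{(1)}, x ∈ B(y)∖{y} of (9) — print uses ONE axial gauge
in (9) and (10), so an instantiation must take `Ax i` = the bond set of the SAME contour system `cd : Setup.ContourData` that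
`Eq9 cd` speaks about — the lane's carrier seat p1 instantiates BOTH by the radial forest of [5] (1.7): `cd :=
Carriers.radialContourData` (holonomy = ordered product along Γ_{y,x}), `Ax i := Carriers.radialBonds (Ω₁ i)` with
`radialBonds {y} = ⋃_x bonds(Γ_{y,x})` (lane ruling R-FOREST option 1; Summits-side names, not imported here); «ζ_{Ω₁ᶜ}χ_{Ω₁}» ↦ the weight
`ζχ i : Density` (print's instantiation: `B10Decomposition7.zetaDom · chiDom` at `dev U p = dist1 (U(∂p))`, threshold
ε₁ = g₀p(g₀) of (7)); «exp[−(1/g₀²)A(U) − E]» ↦ `R.rho0` ((1), `rfl`)⟧.  Hypothesis-shaped; it is the carrier seat's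
THEOREM for the constructed run (`formula10_sum`/`eq10_run3`, Summits-side), never asserted here. [cite: Balaban1985UV3, (10) p.258] -/
def Eq10 (R : Setting.RunObjects S G) {ι : Type} (s : Finset ι) (ζχ : ι → Balaban1983to89.Density S.P 0 G)
    (Ax : ι → Finset (Balaban1983to89.PBond S.P 0)) : Prop :=
  ∀ f : Balaban1983to89.GaugeField S.P 1 G → ℝ, Measurable f → (∃ C : ℝ, ∀ V, |f V| ≤ C) →
    ∫ V, R.rho 1 V * f V ∂(Balaban1983to89.fieldMeasure S.P 1 G)
      = ∑ i ∈ s, ∫ U, (ζχ i (T4TreeGaugeFixing.fixTo (Ax i) 1 U) * R.rho0 (T4TreeGaugeFixing.fixTo (Ax i) 1 U))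
            * f ((R.av 0).avg (T4TreeGaugeFixing.fixTo (Ax i) 1 U)) ∂(Balaban1983to89.fieldMeasure S.P 0 G)

end Eq10

/-! ## (14)–(16) pp. 259 = PDF 5 L22–40: the averaged fluctuation field in the chart `U′ = e^{iA′}` -/

section Chart

variable (𝔸 : Type*) [NormedRing 𝔸] [NormedAlgebra ℂ 𝔸] [CompleteSpace 𝔸] (β C : Type*)

/-- The objects of (14)–(16) pp. 259–260, as binders over a complete normed `ℂ`-algebra `𝔸` (the matrix model `M_N(ℂ) ⊃
G`, `𝔤`; [4] p. 18): `β` = the bonds of `Ω₁` carrying the fluctuation variables `A′(b)` (p. 259 L12 «all configurations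
V′ = e^{iA′} satisfying |A′| < 16·3²L²B₃g₀p(g₀) on Ω₁», radius `r`), `C` = the bonds of `Ω₁^{(1)}` (the δ-functions of (13),
(16) are indexed by `c ∈ Ω₁^{(1)}`); `U₁` = the background field of (12) on `β` (p. 259 L6–7 «the minimal configuration U₁
is called a background field»); `avg` = the averaging operation `U ↦ Ū` of [4] (15) on `𝔸`-valued bond configurations
(binder; p. 259 L26 «the definition (89) (or (63)) in [4]»); `Q` = the function `Q(A′) = Q(U₁, A′)` DEFINED by (14). [cite: Balaban1985UV3, (14) p.259] -/
structure AvgChart where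
  /-- the background field `U₁` on the bonds of `Ω₁` -/
  U₁ : β → 𝔸
  /-- the averaging operation of [4] on `𝔸`-valued configurations, to the bonds `c ∈ Ω₁^{(1)}` -/
  avg : (β → 𝔸) → C → 𝔸
  /-- `Q(A′) = Q(U₁, A′)` of (14), `𝔤`-valued, per coarse bond -/
  Q : (β → 𝔸) → C → 𝔸
  /-- «A′ sufficiently small»: the radius of the fluctuation domain of (13), in print the positive number
  `16·3²L²B₃g₀p(g₀)` of p. 259 L12 («all configurations V′ = e^{iA′} satisfying |A′| < 16·3²L²B₃g₀p(g₀) on Ω₁») -/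
  r : ℝ
  /-- the radius is positive (print: `16·3²L²B₃g₀p(g₀)` with `g₀, B₃, p(g₀) > 0`) — so that (14)/(16) are not vacuous -/
  r_pos : 0 < r

variable {𝔸 β C}

/-- The fluctuation field in the chart, `U′ = e^{iA′}` bondwise (p. 259 L12 «V′ = e^{iA′}»), times the background:
`(U′U₁)(b) = e^{iA′(b)} U₁(b)` (p. 259 L5 «taking U = U′U₁»). [cite: Balaban1985UV3, (13) p.259] -/
noncomputable def AvgChart.fluct (𝒞 : AvgChart 𝔸 β C) (A' : β → 𝔸) : β → 𝔸 :=
  fun b => NormedSpace.exp (Complex.I • A' b) * 𝒞.U₁ b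

/-- **(14)** p. 259 = PDF 5 L22–29, verbatim: «Now we write the integrals over U′ in terms of the variables A′. For the
expressions in δ-functions defining the renormalization transformation we have  (\overline{U′U₁})(Ū₁)^{−1} = Ũ′ = U̿′ =
exp iQ(A′),  (14)  where the second equality follows from the definition (89) (or (63)) in [4], and the gauge fixing
conditions. Properties of the function Q(A′) = Q(U₁, A′) were described in Proposition 3 [4].»  Typed multiplicatively
(no inverse of `Ū₁(c)` needed): for `A′` in the fluctuation domain, `\overline{U′U₁}(c) = exp(iQ(A′, c)) · Ū₁(c)` for every
`c ∈ Ω₁^{(1)}`.  The middle members `Ũ′ = U̿′` are [4]'s names ((63), (89) pp. 28, 31) for the same element and are not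
separate objects here.  Hypothesis-shaped (it DEFINES `Q` given the average of [4]; binder [4] Prop 3 p. 36 = typer-2's
`Binders`). [cite: Balaban1985UV3, (14) p.259] -/
def Eq14 (𝒞 : AvgChart 𝔸 β C) : Prop :=
  ∀ A' : β → 𝔸, (∀ b, ‖A' b‖ < 𝒞.r) →
    ∀ c : C, 𝒞.avg (𝒞.fluct A') c = NormedSpace.exp (Complex.I • 𝒞.Q A' c) * 𝒞.avg 𝒞.U₁ c

/-- **(15)** p. 259 = PDF 5 L29–33, verbatim: «It is an analytic function of A′ with the decomposition  Q(A′) = QA′ +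
C(A′),  (15)  where Q = Q(U₁) is the linear averaging operator defined by (124) [4], and C(A′) is an analytic function
with an expansion beginning with a second order polynomial.»  Typed (for `β`, `C` finite, so that `β → 𝔸`, `C → 𝔸` are
normed spaces; scalar field `𝕜` explicit, as in `B10SectAStatements.Eq17`): on the ball of radius `r`, `Q` is analytic,
`Q = Qlin + Cnl` with `Qlin` a continuous LINEAR map (binder: the operator (124) of [4], typer-2's `Binders`) and `Cnl`
analytic with `Cnl 0 = 0` and zero derivative at `0` («beginning with a second order polynomial»).  Hypothesis-shaped
leaf (print: Proposition 3 of [4]). [cite: Balaban1985UV3, (15) p.259] -/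
def Eq15 [Fintype β] [Fintype C] (𝕜 : Type*) [NontriviallyNormedField 𝕜] [NormedSpace 𝕜 𝔸] (𝒞 : AvgChart 𝔸 β C)
    (Qlin : (β → 𝔸) →L[𝕜] (C → 𝔸)) (Cnl : (β → 𝔸) → C → 𝔸) : Prop :=
  AnalyticOn 𝕜 𝒞.Q (Metric.ball 0 𝒞.r) ∧
    (∀ A' : β → 𝔸, 𝒞.Q A' = Qlin A' + Cnl A') ∧
    AnalyticOn 𝕜 Cnl (Metric.ball 0 𝒞.r) ∧ Cnl 0 = 0 ∧ HasFDerivAt Cnl (0 : (β → 𝔸) →L[𝕜] (C → 𝔸)) 0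

/-- **(16)** p. 259 = PDF 5 L33–37, verbatim: «The δ-function in (13) can be written as  Π_{c∈Ω₁^{(1)}}
δ((\overline{U′U₁})(c)(Ū₁(c))^{−1}) = Π_{c∈Ω₁^{(1)}} (1/σ₀) δ(Q(A′, c)),  (16)  where the δ-functions on the right are defined
on the vector space 𝔤, and concentrated at the origin of this space. The constant σ₀ will be discussed later.» (p. 260
L19–20: «dU′ = σ(A′)dA′ = σ₀ σ/σ₀ (A′)dA′, σ₀ = σ(0), where dA′ is the Lebesque ⟦sic⟧ measure on 𝔤»).  The display is a
change of variables in δ-functions; its two ingredients are typed separately: (a) THIS decl — on the fluctuation domain the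
constraint «\overline{U′U₁}(c) = Ū₁(c)» of the left member and the constraint «Q(A′, c) = 0» of the right member cut out
the same set (by (14), `exp(iQ) = 1 ⟺ Q = 0` for small `Q`); (b) the Jacobian constant `1/σ₀` per coarse bond, `σ₀ = σ(0)`
the Haar density at the origin of the chart — its bookkeeping into the factor `exp[log σ₀|Ω₁*|]` of (18)/(22) is the 4D
cell's `B10Eq22Rescaling.haar_density_split`/`sigma0_pow_bookkeeping` (PROVED there), the density `σ` itself is the
carrier seat's object (PLAN §3.1 p1, `σ(A)` of p. 260 for SU(2) = `B10Eq22Rescaling.sigmaSU2`).  Hypothesis-shaped; it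
FOLLOWS from (14) given two carrier obligations NOT IN PRINT as stated — «Ū₁(c) is a unit» ([4] (15) p. 19: Ū ∈ G) and
«‖Q(A′, c)‖ < 1 on the domain» (the smallness p. 259 L12 «for g₀ sufficiently small», [4] Prop 3 p. 36) — the lane's
prover seat p4, `eq16_of_eq14`. [cite: Balaban1985UV3, (16) p.259] -/
def Eq16 (𝒞 : AvgChart 𝔸 β C) : Prop :=
  ∀ A' : β → 𝔸, (∀ b, ‖A' b‖ < 𝒞.r) →
    ∀ c : C, 𝒞.avg (𝒞.fluct A') c = 𝒞.avg 𝒞.U₁ c ↔ 𝒞.Q A' c = 0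

end Chart

end Literature.MathematicalPhysics.QuantumFieldTheory.Balaban1985CMP102.SectA
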